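import Literature.Geometry.Kaehler.IrreducibleComponents
import Literature.Geometry.Kaehler.AnalyticSetComponentsLocFinProofs

/-!
# The decomposition `Z = ⋃ⱼ cl Sⱼ` (Chirka §5.4 Thm. (2))

Discharge of the named fact
`Literature.Geometry.Kaehler.IsAnalyticSet.eq_iUnion_closure_connectedComponentIn`
(`Literature/Geometry/Kaehler/IrreducibleComponents.lean`, [Chirka1989, §5.4 Thm. (2), p. 57]):
an analytic subset `Z` of a complex manifold is the union of the closures `cl Sⱼ` of the
connected components `Sⱼ` of its regular locus `reg Z`.

The printed proof is one line: `Z = cl (reg Z)` (density of regular points,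
[Chirka1989, §2.3 Thm.], in the tree `IsAnalyticSet.subset_closure_regularLocus_holds`) and
`cl ⋃ⱼ Sⱼ = ⋃ⱼ cl Sⱼ` because the family `(Sⱼ)` is locally finite ([Chirka1989, §5.1 Thm. (1)],
in the tree the named fact `IsAnalyticSet.finite_connectedComponentIn_regularLocus_inter_compact`
of `AnalyticSetComponents.lean`, discharged in `AnalyticSetComponentsLocFinProofs.lean`).
Accordingly this file proves:

* `IsAnalyticSet.iUnion_closure_connectedComponentIn_subset` — the inclusion `⊇` (elementary:
  `Z` is closed);
* `IsAnalyticSet.eq_iUnion_closure_connectedComponentIn_of_finite` — **§5.1 Thm. (1) ⇒ §5.4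
  Thm. (2)**, exactly as in print (finite-dimensional manifolds are locally compact, so a point of
  `Z` has a compact neighbourhood `K`, which meets only finitely many `Sⱼ`; a finite union of
  closed sets is closed).

* `IsAnalyticSet.eq_iUnion_closure_connectedComponentIn_holds` — the discharge, feeding the
  reduction with `IsAnalyticSet.finite_connectedComponentIn_regularLocus_inter_compact_holds`.

No new definitions and no new named facts (D-0026): theorems only.

## References

* E. M. Chirka, *Complex Analytic Sets*, Kluwer 1989, Ch. 1 §5.1 Thm. (1) (p. 52), §5.4 Thm. (2)
  (p. 57) [Chirka1989].
-/

open scoped Manifold ContDiff Topology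
open Set

namespace Literature.Geometry.Kaehler

variable {E : Type*} [NormedAddCommGroup E] [NormedSpace ℂ E]
  {H : Type*} [TopologicalSpace H] {I : ModelWithCorners ℂ E H}
  {M : Type*} [TopologicalSpace M] [ChartedSpace H M]

/-- The inclusion `⋃ⱼ cl Sⱼ ⊆ Z` of [Chirka1989, §5.4 Thm. (2)] is elementary: each component
`Sⱼ` of `reg Z` lies in `Z`, which is closed. [cite: Chirka1989, §5.4 Thm. (2), p. 57] -/
theorem IsAnalyticSet.iUnion_closure_connectedComponentIn_subset {Z : Set M}
    (hZ : IsAnalyticSet I Z) :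
    ⋃ y ∈ regularLocus I Z, closure (connectedComponentIn (regularLocus I Z) y) ⊆ Z :=
  iUnion₂_subset fun _ _ =>
    closure_minimal ((connectedComponentIn_subset _ _).trans (regularLocus_subset Z)) hZ.isClosed

variable (I) (M) in
/-- **§5.1 Thm. (1) ⇒ §5.4 Thm. (2)** (the printed proof). If the connected components `Sⱼ` of
the regular locus of every analytic subset form a locally finite family
(`IsAnalyticSet.finite_connectedComponentIn_regularLocus_inter_compact`,
[Chirka1989, §5.1 Thm. (1)]), then `Z = ⋃ⱼ cl Sⱼ` for every analytic `Z`: by the density of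
regular points (`IsAnalyticSet.subset_closure_regularLocus_holds`) a point `x ∈ Z` lies in
`cl (reg Z ∩ K)` for a compact neighbourhood `K` of `x` (finite-dimensional manifolds are
locally compact), and `reg Z ∩ K` is covered by the finitely many `Sⱼ` meeting `K`, whose
closures have a closed union. [cite: Chirka1989, §5.4 Thm. (2) (proof), p. 57] -/
theorem IsAnalyticSet.eq_iUnion_closure_connectedComponentIn_of_finite
    (hfin : IsAnalyticSet.finite_connectedComponentIn_regularLocus_inter_compact I M) :
    IsAnalyticSet.eq_iUnion_closure_connectedComponentIn I M := by
  intro _ _ _ Z hZ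
  refine Subset.antisymm (fun x hx => ?_) hZ.iUnion_closure_connectedComponentIn_subset
  haveI : LocallyCompactSpace M := Manifold.locallyCompact_of_finiteDimensional I
  obtain ⟨K, hK, hKx⟩ := exists_compact_mem_nhds x
  -- the finitely many components meeting `K`
  set F : Set (Set M) :=
    {S : Set M | (∃ y ∈ regularLocus I Z, S = connectedComponentIn (regularLocus I Z) y) ∧
      (S ∩ K).Nonempty} with hF
  have hFfin : F.Finite := hfin hZ hK
  -- their closures have a closed union `T ⊇ reg Z ∩ K`
  set T : Set M := ⋃ S ∈ F, closure S with hT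
  have hTc : IsClosed T := hFfin.isClosed_biUnion fun _ _ => isClosed_closure
  have hsub : regularLocus I Z ∩ K ⊆ T := by
    rintro y ⟨hy, hyK⟩
    have hyS : y ∈ connectedComponentIn (regularLocus I Z) y := mem_connectedComponentIn hy
    exact mem_biUnion (show connectedComponentIn (regularLocus I Z) y ∈ F from
      ⟨⟨y, hy, rfl⟩, y, hyS, hyK⟩) (subset_closure hyS)
  -- `x ∈ cl (reg Z ∩ K) ⊆ T`
  have hxcl : x ∈ closure (regularLocus I Z ∩ K) := by
    have hx' : x ∈ closure (regularLocus I Z) :=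
      IsAnalyticSet.subset_closure_regularLocus_holds I M hZ hx
    rw [mem_closure_iff_nhds] at hx' ⊢
    intro t ht
    obtain ⟨y, hyt, hy⟩ := hx' (t ∩ K) (Filter.inter_mem ht hKx)
    exact ⟨y, hyt.1, hy, hyt.2⟩
  have hxT : x ∈ T := closure_minimal hsub hTc hxcl
  obtain ⟨S, ⟨⟨y, hy, rfl⟩, -⟩, hxS⟩ := mem_iUnion₂.1 hxT
  exact mem_biUnion hy hxS

variable (I) (M) in
/-- **Chirka §5.4 Theorem, part (2), discharged** (the named fact
`Literature.Geometry.Kaehler.IsAnalyticSet.eq_iUnion_closure_connectedComponentIn`): *if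
`reg Z = ⋃ⱼ Sⱼ` is the decomposition of the regular locus of an analytic subset `Z` of a complex
manifold into connected components, then `Z = ⋃ⱼ cl Sⱼ`.* As in print: the family `(Sⱼ)` is
locally finite ([Chirka1989, §5.1 Thm. (1)],
`IsAnalyticSet.finite_connectedComponentIn_regularLocus_inter_compact_holds`) and `reg Z` is dense
in `Z` ([Chirka1989, §2.3 Thm.]); the reduction is
`IsAnalyticSet.eq_iUnion_closure_connectedComponentIn_of_finite`.
[cite: Chirka1989, §5.4 Thm. (2), p. 57] -/
theorem IsAnalyticSet.eq_iUnion_closure_connectedComponentIn_holds :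
    IsAnalyticSet.eq_iUnion_closure_connectedComponentIn I M := by
  intro _ _ _ Z hZ
  exact IsAnalyticSet.eq_iUnion_closure_connectedComponentIn_of_finite I M
    (@IsAnalyticSet.finite_connectedComponentIn_regularLocus_inter_compact_holds _ _ _ _ _ I M _ _) hZ

end Literature.Geometry.Kaehler
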